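import Literature.NumberTheory.EllipticCurves.Kato2004.EulerSystemValues
import Literature.NumberTheory.EllipticCurves.KummerSelmerStructure
import Summits.BirchSwinnertonDyer.Rank1Residual.GaloisImage.PropagatedStructure
import HarnessLib

/-!
# The (P-EXP) rider of the route-1 PORT at a finite level: `KatoExpStarFiniteLevelAt`
# (sub-target R1-65 = PK-5; cell `b2b-bsdres`, team n1011, seat p13 GEN 13; binder sheet
# `cells/n1011/ROUTE-1.md` §53.4 with design decisions D-53-1 … D-53-7, r1 GEN 41)

HONEST FRAMING (cell `b2b-bsdres`, run/shared/lean/b2b/bsd-rank1-residual/, verbatim in every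
file): the goal of the cell is to DELETE the COMBINATION-SHAPED residual classes of the
Birch–Swinnerton-Dyer formula for ALL analytic-rank `≤ 1` elliptic curves over `ℚ` — "full BSD
formula for every rank `≤ 1` curve in class `C`" assembled STRICTLY from published theorems — so
that the rank-`≤ 1` remainder becomes exactly the CONSTRUCTION-SHAPED classes, which are TYPED
(missing-input `Prop`s), NOT attempted. This is not "finishing BSD". Team n1011: research route on
the CONSTRUCTION-SHAPED class X4 / §I N11 (route-1 PORT `T-PORT-1`, §3 (P-EXP)).  THIS FILE TYPES A
HYPOTHESIS, IT PROVES NOTHING ABOUT ANY CURVE: `KatoExpStarFiniteLevelAt` is a `Prop`-valued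
PREDICATE on explicitly bound witnesses (a missing-input / CONSTRUCTION-SHAPED rider), to be taken as
a hypothesis `(hfin : KatoExpStarFiniteLevelAt …)` by the PORT's END (PK-6); it is NOT a Literature
fact, it carries no `_holds` (none is possible before `D_dR` / the dual exponential exist in the tree),
and asserting it for a curve is a DEBT of whoever assumes it.  FLAG `BK90-§3 + local-duality + SAT@3
(r1 §53)`.  Nothing is booked; no mark / label / count moves; 0 Literature facts; definitions with
bodies only.

## What, and why

The PORT of record at the additive prime `3` (`KatoKuriharaDictionaryThreeAt`, DICT3, flag
`K22-Thm3.13-PORT@3`) asserts, among Kato's derivative classes and the Mazur–Rubin bridge (THEOREMS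
A–D of row T-DER), two VALUE clauses about a functional
`Λfin : H¹(ℚ₃, E[3^k·3]) →+ ℤ/3^{k+1}` ("`ι ∘ 3^t · exp*_{ω_E} mod 3^{k+1}`"): **(Λ)** on
`𝓕_can(v₃) = im(H¹(ℚ₃, T₃E) → H¹(ℚ₃, E[3^{k+1}]))` it is onto `ℤ/3^{k+1}` with kernel the Kummer part,
and **(DICT3)** `Λfin(loc₃ κ_d) = u_d · 3^t · δ̃_{n(d)}`.  The cited Euler-system fact
`Kato2004.exists_eulerSystem_expStar_values` / its matrix `Kato2004.ZetaBody` (p316481) carries the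
dual exponential as an ABSTRACT datum `Λ_{k,r} : H¹(ℚ(μ_m), T_pE) →ₗ[ℤ_p] ℚ_p ⊗_ℚ ℚ(ζ_m)` on the
cyclotomic LEVELS, with NO integrality and NO statement on torsion coefficients (its docstring:
"X1-int / X2 … the consumer's `hIdx`, [BK90]/local duality — not Kato").  The link between the two —
print's "extension of the dual exponential map to torsion coefficients" ([Kim2022StructureSelmer]
§3.3, Lemma 3.11 / Prop. 3.12; [KimNakamura2020] Cor. 2.4) and the semi-local descent step of the
proof of [Kim2022StructureSelmer] Thm. 3.13 (arXiv v3 pp. 26–27) — is NOT constructible in the tree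
(no `B_dR`, no completions of the level fields).  ROUTE-1 §53.4 (ruling Q-E = E1) therefore types it
as ONE rider predicate on the pair `(Λ, Λfin)`:

* **(i)** = DICT3's two (Λ)-clauses VERBATIM for `Λfin` (absorbing the older riders `hKer₃`/`hIdx₃`);
* **(ii) TAME-LEVEL SCALAR COMPATIBILITY**: for every TAME level `r` (`m = ∏_{q∈r} ℓ_q`, no
  `p`-power: D-53-2), every `y ∈ H¹(ℚ(μ_m), T_pE)`, every `κ₀ ∈ H¹(ℚ, E[p^{k+1}])` whose restriction to
  `Gal(ℚ̄/ℚ(μ_m))` is the reduction of `y` (the SHAPE of THEOREM A3's derivative class,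
  `Derivative.existsUnique_res_eq_deriv`, with the coefficient change of
  `Derivative.CoeffChange.EC.map_eq_of_res_eq_deriv` — the reduction is bound as there: ANY additive
  map `Ψ` on `H¹` of the level computed on cocycles by `a ↦ a_{k+1}`), with `loc_v κ₀ ∈ 𝓕_can(v)`, and
  every `p`-adic integer `s`: IF `p^t · Λ_{0,r}(y) ≡ s ⊗ 1 (mod p^{k+1} · L_int(m))`,
  `L_int(m) := ℤ_p ⊗ ℤ[ζ_m]` (the `ℤ_p`-span of the `1 ⊗ ζ_m^j`, `cycIntLattice`), THEN
  `Λfin(loc_v κ₀) = s mod p^{k+1}`.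

DESIGN DECISIONS (r1, ROUTE-1 §53.4 / §53.12, recorded verbatim in substance).  **D-53-1** clause
(ii) is an IMPLICATION about SCALARS, never a lattice statement about `Λ_{0,r}`: the lattice
inclusion `p^t · Λ_{0,r}(H¹) ⊆ L_int` — the right-hand column of the reciprocity diagram in the
printed proof of [Kim2022StructureSelmer] Thm. 3.13 — is FALSE in general at an additive `p ∈ {3,5,7}`
(it fails prime by prime over `K = ℚ(μ_m)_𝔓` whenever `E₀(K)[p] ≠ 0 = E(ℚ_p)[p]`; r1's toy
certificate `y² = x³ + 3x² + 3` at `ℚ₉`, ROUTE-1 §53.2), while the scalar conclusion survives at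
full strength by r1's LEMMA SAT (below).  **D-53-2** TAME levels only (`k' = 0`): the Kolyvagin /
Mazur–Rubin argument and THEOREM B use no `p`-power levels, and SAT's proof needs `K/ℚ_p`
unramified.  **D-53-3** ONE coordinate: `Λ` and `Λfin` are both read in the row's `ω_E`-coordinate BY
CHOICE of witnesses (`ZetaBody` is invariant under `(κ, Λ, x) ↦ (cκ, cΛ, cx)`, `c ∈ ℚˣ`), so NO
period-ratio binder sits inside this predicate; the price is the row's `hNorm₃ : ∃ u : ℚ, (u : ℝ) = κ ∧
padicValRat 3 u = 0` (§53.5).  **D-53-4** no trace / `pr₁` functional, no normal basis, no unit in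
(ii) (units live in DICT3's value clause, produced by PK-6 from the row certificates).  **D-53-5**
`Λfin` is canonical on `𝓕_can(v)` for every `t`, so no splitting datum ([Kim2022StructureSelmer]
§3.3.2) is displayed; `t` enters only through `p^t`.  **D-53-6** STATUS OF (ii): it is TRUE for Kato's
witnesses (`Λ` = semi-local `exp*_{ω_E} ∘ loc_p`, `Λfin = ι ∘ p^t·exp*_{ω_E} mod p^{k+1}`) by local
Tate duality + r1's LEMMA SAT (ROUTE-1 §53.3 — a DERIVATION, not print; nearest print
[Kim2022StructureSelmer] Cor. 3.5 and the proof of Thm. 3.13, [KimNakamura2020] Thm. 2.1 / Cor. 2.4);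
it is an AXIOM on the bound witnesses, not a consequence of `ZetaBody`.  LEMMA SAT (r1; `p ≥ 3`,
`E/ℚ_p` additive, `K/ℚ_p` finite unramified, `t = dim E(ℚ_p)[p] ∈ {0,1}`,
`M_K = exp*_ω(H¹(K,T)) = Λ_K^∨`, `Λ_K = log_ω(E(K) ⊗ ℤ_p)`): `(𝓞_K + p^t·M_K) ∩ ℚ_p ⊆ ℤ_p`; at
`t = 1` because `Λ_K ⊇ log Ê(𝔪_K) = p𝓞_K`, at `t = 0` because `λ : E₀(K)/E₁(K) ≅ k⁺ → 𝓞_K/p` is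
`G`-equivariant with `λ ∘ N_{K/ℚ_p} = Tr ∘ λ`, the norm on `E₀/E₁` is onto and `λ_{ℚ_p}` is
injective at `t = 0`, so `Tr(Λ₀) ⊄ pℤ_p`; no hypothesis on `E₀(K)[p]`, `c_v`, the Kodaira type or the
residue degree; second-read by n1011-lit GEN 25.  **D-53-7** CONSISTENCY OF (ii) (§53.12): two
`T`-lifts `y`, `y + p^{k+1}w` of the same `κ₀` meeting the premise with scalars `s`, `s′` give
`((s − s′)/p^{k+1}) ⊗ 1 ∈ L_int + p^t·M`, hence `s ≡ s′ (mod p^{k+1})` by SAT — at EVERY tame level,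
even residue degree included; in the kernel the shadow of this is `toZModPow_eq_of_premise` (any
witness pair makes the scalar well defined).

What E1 costs / saves (r1): riders per PORT-served row `3 → 2` (`hfin`, `hNorm₃`), facts `+0`,
definitions `+2` (this predicate and the lattice `cycIntLattice`, both with bodies).  The consumer
PK-6 (`KatoKuriharaDictionaryThree…_of_zetaBody`, R1-68) instantiates (ii) with
`y := D_r · (z 0 r)` (THEOREM A's derivative, `Λ 0 r y = 1 ⊗ D_r^{field}(x 0 r)` by PK-1 from
`ZetaBody` C3a/C4), `κ₀ :=` THEOREM A3's class, `s := p^t · (unit) · δ̃_n` (PK-3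
`MazurTateDerivative.mapRingHom_padicLift_mul_prod_deriv_eq_kuriharaNumber_smul`, PK-2/PK-4, T-R18b,
`hNorm₃`).  NOT here: any proof that a given `(Λ, Λfin)` satisfies the predicate; any `exp*`; the
`p`-power levels (a consumer needing them files a new rider, D-53-2); E2 (constructing `Λfin` from
`Λ`).  Stated for a general prime `p` and place `v` (every clause is `p`-uniform; the PORT uses
`p = 3`, `v = v₃`).

References: S. Bloch, K. Kato, *L-functions and Tamagawa numbers of motives* (1990) §3, Ex. 3.11
[BlochKato1990]; C.-H. Kim, AJM 148 (2026) = arXiv:2203.12159, §3.3 (Lemma 3.11, Prop. 3.12),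
§3.4.1, Thm. 3.13 and its proof [Kim2022StructureSelmer]; C.-H. Kim, K. Nakamura, JNT 210 (2020) =
arXiv:1808.07726, Thm. 2.1, Cor. 2.4 [KimNakamura2020]; K. Kato, Astérisque 295 (2004), §9.4, Thm. 9.7
[Kato2004Asterisque]; K. Rubin, *Euler Systems* (2000), Def. 4.4.4 [Rubin2000]; design of record
`cells/n1011/ROUTE-1.md` §47.2, §48.4, §53.2–53.6, §53.12 (r1), `cells/n1011/skel/T-PORT-1-PKIM.md`
§4–§5 (p13 GEN 12), n1011-lit GEN 25 (second read of §53.3).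
-/

noncomputable section

open scoped NumberField TensorProduct
open IsDedekindDomain NumberField WeierstrassCurve
open Literature.NumberTheory.GaloisRepresentations
open Literature.NumberTheory.EllipticCurves Literature.NumberTheory.EllipticCurves.Kato2004
open Literature.NumberTheory.EllipticCurves.Kato2004.EulerSystemValues

namespace Summit.BirchSwinnertonDyer.Rank1Residual.GaloisImage

/-! ### The integral lattice `ℤ_p ⊗ ℤ[ζ_m] ⊆ ℚ_p ⊗_ℚ ℚ(ζ_m)` of ROUTE-1 §53.4 (basis-free span) -/

set_option backward.isDefEq.respectTransparency false in
/-- **`L_int(m) = ℤ_p ⊗ ℤ[ζ_m]`** inside `ℚ_p ⊗_ℚ ℚ(ζ_m)`: the `ℤ_p`-span of the pure tensors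
`1 ⊗ ζ_m^j`, `j ≥ 0`, `ζ_m` the distinguished primitive root of `CyclotomicField m ℚ` (basis-free; for
squarefree `m` prime to `p` this is `∏_{𝔓 ∣ p} 𝓞_{ℚ(μ_m)_𝔓}`, the semi-local ring of integers —
ROUTE-1 §53.3/§53.12 wording (b0)). [folklore] -/
def cycIntLattice (p : ℕ) [Fact p.Prime] (m : ℕ) [NeZero m] :
    Submodule ℤ_[p] (ℚ_[p] ⊗[ℚ] CyclotomicField m ℚ) :=
  Submodule.span ℤ_[p]
    (Set.range fun j : ℕ =>
      (1 : ℚ_[p]) ⊗ₜ[ℚ] IsCyclotomicExtension.zeta m ℚ (CyclotomicField m ℚ) ^ j)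

set_option backward.isDefEq.respectTransparency false in
/-- The generators `1 ⊗ ζ_m^j` lie in `L_int(m)`. [folklore] -/
theorem one_tmul_zeta_pow_mem_cycIntLattice (p : ℕ) [Fact p.Prime] (m : ℕ) [NeZero m] (j : ℕ) :
    (1 : ℚ_[p]) ⊗ₜ[ℚ] IsCyclotomicExtension.zeta m ℚ (CyclotomicField m ℚ) ^ j ∈ cycIntLattice p m :=
  Submodule.subset_span ⟨j, rfl⟩

set_option backward.isDefEq.respectTransparency false in
/-- `1 ⊗ 1 ∈ L_int(m)`. [folklore] -/
theorem one_tmul_one_mem_cycIntLattice (p : ℕ) [Fact p.Prime] (m : ℕ) [NeZero m] :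
    (1 : ℚ_[p]) ⊗ₜ[ℚ] (1 : CyclotomicField m ℚ) ∈ cycIntLattice p m := by
  have h := one_tmul_zeta_pow_mem_cycIntLattice p m 0
  rwa [pow_zero] at h

/-! ### The rider predicate -/

/-- **(P-EXP) rider of the route-1 PORT at a finite level — `KatoExpStarFiniteLevelAt`
(ROUTE-1 §53.4, Q-E = E1; a CONSTRUCTION-SHAPED missing-input predicate, flag
`BK90-§3 + local-duality + SAT@3 (r1 §53)`; never `_holds`; NOT Kato print).**  For `W/ℚ`, a prime
`p`, a depth `k` (module `E[p^k·p]`, values mod `p^{k+1}`), the torsion exponent `t`, a finite place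
`v` (intended `v ∣ p`), Kato's dual-exponential value datum `Λ = (Λ_{k',r})` EXACTLY as bound in
`hbody : Kato2004.ZetaBody W p f ι κ Λ c d a A z x`, and a functional
`Λfin : H¹(ℚ_v, E[p^k·p]) →+ ℤ/p^{k+1}` (the one then fed to `KatoKuriharaDictionaryThreeAt`), it
says: **(i)** on `𝓕_can(v) = propagatedSelmerStructure W p k (inr v)` the functional `Λfin` is onto
`ℤ/p^{k+1}` and vanishes exactly on the Kummer part `W.kummerSelmerStructure (p^k·p) (inr v)` (DICT3's
(Λ)-clauses verbatim); **(ii)** for every TAME level `r`, every additive `Ψ : H¹(ℚ(μ_r), T_pW) →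
H¹(ℚ(μ_r), E[p^k·p])` computed on cocycles by `a ↦ a_{k+1}` (the coefficient-change binder of
`Derivative.CoeffChange.EC.map_eq_of_res_eq_deriv`; such a `Ψ` is UNIQUE given this cocycle
description — every class is a cocycle class — so quantifying over all of them is no strengthening
of the single reduction map `red_*`), every `y ∈ H¹(ℚ(μ_r), T_pW)`, every
`κ₀ ∈ H¹(ℚ, E[p^k·p])` with `res κ₀ = Ψ y` and `loc_v κ₀ ∈ 𝓕_can(v)`, and every `s ∈ ℤ_p`:
`p^t · Λ_{0,r}(y) − s ⊗ 1 ∈ p^{k+1} · L_int` implies `Λfin(loc_v κ₀) = s mod p^{k+1}`.  Status: (ii)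
is TRUE for Kato's witnesses (for `E` additive at `p ≥ 3`, `v ∣ p`, tame levels) by local Tate duality
+ r1's LEMMA SAT (ROUTE-1 §53.3; derivation, not print; nearest print [Kim2022StructureSelmer]
Cor. 3.5 / proof of Thm. 3.13 and [KimNakamura2020] Thm. 2.1, Cor. 2.4); it is an axiom on the bound
witnesses, not a consequence of `ZetaBody` (D-53-6); consistent under change of `T`-lift by SAT
(D-53-7, ROUTE-1 §53.3/§53.12).  Module docstring
for D-53-1 … D-53-7.  Nothing is asserted by this definition.
[cite: Kim2022StructureSelmer, §3.3 (Lemma 3.11, Prop. 3.12), §3.4.1 and the proof of Thm. 3.13 (arXiv v3 pp. 26–27; = Thm. 3.11 of AJM 148)]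
[cite: BlochKato1990, §3 (Def. 3.10, Ex. 3.11)] [cite: Kato2004Asterisque, §9.4 and Thm. 9.7 (pp. 188–189)] -/
def KatoExpStarFiniteLevelAt (W : WeierstrassCurve ℚ) [W.IsElliptic] (p : ℕ) [Fact p.Prime]
    [ContinuousSMul ℤ_[p] (W.tateModule p)] (k t : ℕ) (v : HeightOneSpectrum (𝓞 ℚ))
    (Λ : ∀ (k' : ℕ) (r : Finset (HeightOneSpectrum (𝓞 ℚ))),
      H1 (tateRep W p) (cycSubgroup p k' r) →ₗ[ℤ_[p]] ℚ_[p] ⊗[ℚ] CyclotomicField (cycLevel p k' r) ℚ)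
    (Λfin : galoisCohomology ((W.torsionGaloisModule ((p : ℤ) ^ k * (p : ℤ))).toLocal
      (Sum.inr v)) 1 →+ ZMod (p ^ (k + 1))) : Prop :=
  -- (i) DICT3's (Λ)-clauses verbatim: onto `ℤ/p^{k+1}` on `𝓕_can(v)`, kernel there = the Kummer part
  (∀ c : ZMod (p ^ (k + 1)), ∃ x ∈ propagatedSelmerStructure W p k (Sum.inr v), Λfin x = c) ∧
  (∀ x ∈ propagatedSelmerStructure W p k (Sum.inr v),
      Λfin x = 0 ↔ x ∈ W.kummerSelmerStructure ((p : ℤ) ^ k * (p : ℤ)) (Sum.inr v)) ∧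
  -- (ii) tame-level scalar compatibility with Kato's `Λ` (D-53-1: an implication about scalars)
  ∀ (r : Finset (HeightOneSpectrum (𝓞 ℚ)))
    (Ψ : H1 (tateRep W p) (cycSubgroup p 0 r) →+
      continuousCohomology 1
        (subgroupRep (W.torsionGaloisModule ((p : ℤ) ^ k * (p : ℤ))).toTopRep (cycSubgroup p 0 r))),
    (∀ (φ : contOneCocycles (subgroupRep (tateRep W p).toTopRep (cycSubgroup p 0 r)))
        (ψ : contOneCocycles
          (subgroupRep (W.torsionGaloisModule ((p : ℤ) ^ k * (p : ℤ))).toTopRep (cycSubgroup p 0 r))),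
        (∀ g, ((ψ.1 g : geomTorsion W ((p : ℤ) ^ k * (p : ℤ))) : geomPoints W) =
          TateModule.proj p (k + 1) (φ.1 g)) →
        Ψ (oneCocycleClass _ φ) = oneCocycleClass _ ψ) →
    ∀ (y : H1 (tateRep W p) (cycSubgroup p 0 r))
      (κ₀ : galoisCohomology (W.torsionGaloisModule ((p : ℤ) ^ k * (p : ℤ))) 1) (s : ℤ_[p]),
      resSubgroup (W.torsionGaloisModule ((p : ℤ) ^ k * (p : ℤ))).toTopRep (cycSubgroup p 0 r) 1 κ₀ =
          Ψ y →
      galoisCohomology.localization (W.torsionGaloisModule ((p : ℤ) ^ k * (p : ℤ))) (Sum.inr v) 1 κ₀ ∈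
          propagatedSelmerStructure W p k (Sum.inr v) →
      (∃ l ∈ cycIntLattice p (cycLevel p 0 r),
          ((p : ℤ_[p]) ^ t) • Λ 0 r y - ((s : ℚ_[p]) ⊗ₜ[ℚ] (1 : CyclotomicField (cycLevel p 0 r) ℚ)) =
            ((p : ℤ_[p]) ^ (k + 1)) • (l : ℚ_[p] ⊗[ℚ] CyclotomicField (cycLevel p 0 r) ℚ)) →
      Λfin (galoisCohomology.localization (W.torsionGaloisModule ((p : ℤ) ^ k * (p : ℤ)))
          (Sum.inr v) 1 κ₀) = PadicInt.toZModPow (k + 1) s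

namespace KatoExpStarFiniteLevelAt

variable {W : WeierstrassCurve ℚ} [W.IsElliptic] {p : ℕ} [Fact p.Prime]
  [ContinuousSMul ℤ_[p] (W.tateModule p)] {k t : ℕ} {v : HeightOneSpectrum (𝓞 ℚ)}
  {Λ : ∀ (k' : ℕ) (r : Finset (HeightOneSpectrum (𝓞 ℚ))),
    H1 (tateRep W p) (cycSubgroup p k' r) →ₗ[ℤ_[p]] ℚ_[p] ⊗[ℚ] CyclotomicField (cycLevel p k' r) ℚ}
  {Λfin : galoisCohomology ((W.torsionGaloisModule ((p : ℤ) ^ k * (p : ℤ))).toLocal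
    (Sum.inr v)) 1 →+ ZMod (p ^ (k + 1))}

/-- Projection (i-a): `Λfin` is onto `ℤ/p^{k+1}` on `𝓕_can(v)` — DICT3's first (Λ)-clause.
[cite: Kim2022StructureSelmer, §3.3 (Lemma 3.11, Prop. 3.12)] -/
theorem exists_mem_propagated_apply_eq (h : KatoExpStarFiniteLevelAt W p k t v Λ Λfin)
    (c : ZMod (p ^ (k + 1))) :
    ∃ x ∈ propagatedSelmerStructure W p k (Sum.inr v), Λfin x = c :=
  h.1 c

/-- Projection (i-b): on `𝓕_can(v)` the kernel of `Λfin` is the Kummer part — DICT3's second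
(Λ)-clause. [cite: Kim2022StructureSelmer, §3.3 (Lemma 3.11)] -/
theorem apply_eq_zero_iff_mem_kummer (h : KatoExpStarFiniteLevelAt W p k t v Λ Λfin)
    {x : galoisCohomology ((W.torsionGaloisModule ((p : ℤ) ^ k * (p : ℤ))).toLocal (Sum.inr v)) 1}
    (hx : x ∈ propagatedSelmerStructure W p k (Sum.inr v)) :
    Λfin x = 0 ↔ x ∈ W.kummerSelmerStructure ((p : ℤ) ^ k * (p : ℤ)) (Sum.inr v) :=
  h.2.1 x hx

/-- Projection (i): both (Λ)-clauses of `KatoKuriharaDictionaryThreeAt` for `Λfin`, as the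
conjunction DICT3 states them. [cite: Kim2022StructureSelmer, §3.3 (Lemma 3.11, Prop. 3.12)] -/
theorem lambda_clauses (h : KatoExpStarFiniteLevelAt W p k t v Λ Λfin) :
    (∀ c : ZMod (p ^ (k + 1)), ∃ x ∈ propagatedSelmerStructure W p k (Sum.inr v), Λfin x = c) ∧
    (∀ x ∈ propagatedSelmerStructure W p k (Sum.inr v),
      Λfin x = 0 ↔ x ∈ W.kummerSelmerStructure ((p : ℤ) ^ k * (p : ℤ)) (Sum.inr v)) :=
  ⟨h.1, h.2.1⟩

/-- Projection (ii): the TAME-LEVEL SCALAR COMPATIBILITY — if `res κ₀ = Ψ y` (the derivative-class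
shape), `loc_v κ₀ ∈ 𝓕_can(v)` and `p^t Λ_{0,r}(y) ≡ s ⊗ 1 (mod p^{k+1} L_int)`, then
`Λfin(loc_v κ₀) = s mod p^{k+1}` (status: r1 LEMMA SAT, ROUTE-1 §53.3 — an axiom on the witnesses).
[cite: Kim2022StructureSelmer, §3.4.1 and the proof of Thm. 3.13 (arXiv v3 pp. 26–27; = Thm. 3.11 of AJM 148)] -/
theorem apply_localization_eq_toZModPow (h : KatoExpStarFiniteLevelAt W p k t v Λ Λfin)
    (r : Finset (HeightOneSpectrum (𝓞 ℚ)))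
    (Ψ : H1 (tateRep W p) (cycSubgroup p 0 r) →+
      continuousCohomology 1
        (subgroupRep (W.torsionGaloisModule ((p : ℤ) ^ k * (p : ℤ))).toTopRep (cycSubgroup p 0 r)))
    (hΨ : ∀ (φ : contOneCocycles (subgroupRep (tateRep W p).toTopRep (cycSubgroup p 0 r)))
        (ψ : contOneCocycles
          (subgroupRep (W.torsionGaloisModule ((p : ℤ) ^ k * (p : ℤ))).toTopRep (cycSubgroup p 0 r))),
        (∀ g, ((ψ.1 g : geomTorsion W ((p : ℤ) ^ k * (p : ℤ))) : geomPoints W) =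
          TateModule.proj p (k + 1) (φ.1 g)) →
        Ψ (oneCocycleClass _ φ) = oneCocycleClass _ ψ)
    (y : H1 (tateRep W p) (cycSubgroup p 0 r))
    (κ₀ : galoisCohomology (W.torsionGaloisModule ((p : ℤ) ^ k * (p : ℤ))) 1) (s : ℤ_[p])
    (hres : resSubgroup (W.torsionGaloisModule ((p : ℤ) ^ k * (p : ℤ))).toTopRep (cycSubgroup p 0 r)
      1 κ₀ = Ψ y)
    (hloc : galoisCohomology.localization (W.torsionGaloisModule ((p : ℤ) ^ k * (p : ℤ))) (Sum.inr v)
      1 κ₀ ∈ propagatedSelmerStructure W p k (Sum.inr v))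
    (hval : ∃ l ∈ cycIntLattice p (cycLevel p 0 r),
      ((p : ℤ_[p]) ^ t) • Λ 0 r y - ((s : ℚ_[p]) ⊗ₜ[ℚ] (1 : CyclotomicField (cycLevel p 0 r) ℚ)) =
        ((p : ℤ_[p]) ^ (k + 1)) • (l : ℚ_[p] ⊗[ℚ] CyclotomicField (cycLevel p 0 r) ℚ)) :
    Λfin (galoisCohomology.localization (W.torsionGaloisModule ((p : ℤ) ^ k * (p : ℤ)))
        (Sum.inr v) 1 κ₀) = PadicInt.toZModPow (k + 1) s :=
  h.2.2 r Ψ hΨ y κ₀ s hres hloc hval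

/-- **Kernel shadow of D-53-7 (consistency of (ii))**: under the predicate, two scalars `s, s′`
meeting the premise of (ii) for the same `(y, κ₀)` agree mod `p^{k+1}` (both equal
`Λfin(loc_v κ₀)`).  For Kato's witnesses this consistency is r1's LEMMA SAT (ROUTE-1 §53.3/§53.12).
[cite: Kim2022StructureSelmer, the proof of Thm. 3.13 (arXiv v3 pp. 26–27; = Thm. 3.11 of AJM 148)] -/
theorem toZModPow_eq_of_premise (h : KatoExpStarFiniteLevelAt W p k t v Λ Λfin)
    (r : Finset (HeightOneSpectrum (𝓞 ℚ)))
    (Ψ : H1 (tateRep W p) (cycSubgroup p 0 r) →+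
      continuousCohomology 1
        (subgroupRep (W.torsionGaloisModule ((p : ℤ) ^ k * (p : ℤ))).toTopRep (cycSubgroup p 0 r)))
    (hΨ : ∀ (φ : contOneCocycles (subgroupRep (tateRep W p).toTopRep (cycSubgroup p 0 r)))
        (ψ : contOneCocycles
          (subgroupRep (W.torsionGaloisModule ((p : ℤ) ^ k * (p : ℤ))).toTopRep (cycSubgroup p 0 r))),
        (∀ g, ((ψ.1 g : geomTorsion W ((p : ℤ) ^ k * (p : ℤ))) : geomPoints W) =
          TateModule.proj p (k + 1) (φ.1 g)) →
        Ψ (oneCocycleClass _ φ) = oneCocycleClass _ ψ)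
    (y : H1 (tateRep W p) (cycSubgroup p 0 r))
    (κ₀ : galoisCohomology (W.torsionGaloisModule ((p : ℤ) ^ k * (p : ℤ))) 1) (s s' : ℤ_[p])
    (hres : resSubgroup (W.torsionGaloisModule ((p : ℤ) ^ k * (p : ℤ))).toTopRep (cycSubgroup p 0 r)
      1 κ₀ = Ψ y)
    (hloc : galoisCohomology.localization (W.torsionGaloisModule ((p : ℤ) ^ k * (p : ℤ))) (Sum.inr v)
      1 κ₀ ∈ propagatedSelmerStructure W p k (Sum.inr v))
    (hval : ∃ l ∈ cycIntLattice p (cycLevel p 0 r),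
      ((p : ℤ_[p]) ^ t) • Λ 0 r y - ((s : ℚ_[p]) ⊗ₜ[ℚ] (1 : CyclotomicField (cycLevel p 0 r) ℚ)) =
        ((p : ℤ_[p]) ^ (k + 1)) • (l : ℚ_[p] ⊗[ℚ] CyclotomicField (cycLevel p 0 r) ℚ))
    (hval' : ∃ l ∈ cycIntLattice p (cycLevel p 0 r),
      ((p : ℤ_[p]) ^ t) • Λ 0 r y - ((s' : ℚ_[p]) ⊗ₜ[ℚ] (1 : CyclotomicField (cycLevel p 0 r) ℚ)) =
        ((p : ℤ_[p]) ^ (k + 1)) • (l : ℚ_[p] ⊗[ℚ] CyclotomicField (cycLevel p 0 r) ℚ)) :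
    PadicInt.toZModPow (k + 1) s = PadicInt.toZModPow (k + 1) s' := by
  rw [← h.2.2 r Ψ hΨ y κ₀ s hres hloc hval, ← h.2.2 r Ψ hΨ y κ₀ s' hres hloc hval']

end KatoExpStarFiniteLevelAt

end Summit.BirchSwinnertonDyer.Rank1Residual.GaloisImage

end
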